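import Literature.MathematicalPhysics.QuantumFieldTheory.QCDTimeReflection
import Literature.MathematicalPhysics.QuantumLattice.GrassmannRelabelling
import HarnessLib

/-!
# Complex conjugation of coefficients commutes with the Wilsonian effective action
# (BGM 2006 §2.1, symmetry (5): the antilinear symmetry of `P(dψ)` and `V`)

Topic `MathematicalPhysics/QuantumLattice`; companion of `GrassmannRelabelling.lean` (equivariance of `effAction` and of the
kernels under a RELABELLING of the generators — the linear symmetries (1)–(4)) and of
`QuantumFieldTheory/QCDTimeReflection.lean`, whose `grassmannConj : GrassmannAlgebra ℂ Γ →+* GrassmannAlgebra ℂ Γ` is the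
coefficientwise complex conjugation `Σ_I c_I θ_I ↦ Σ_I c̄_I θ_I` (the antilinear ring automorphism fixing the generators).
Benfatto–Giuliani–Mastropietro 2006 §2.1 list as symmetry (5) of the Gaussian integration and of the interaction "complex
conjugation: `ψ^±_{x,σ} → ψ^±_{x,σ}`, `c → c*`", which is used (with (4), (6.a), (6.b)) to constrain the local parts of the
effective potentials (their §2.3 / (2.25): e.g. the reality of the running couplings and `Σ(−k₀) = conj Σ(k₀)`).  This file
proves that the conjugation passes through every layer of the tree's `effAction`:

* `grassmannDeriv_grassmannConj`, `iterDeriv_grassmannConj`, `constPart_grassmannConj`, **`kernel_grassmannConj`** —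
  `∂_X conj = conj ∂_X`, `kernel (conj F) m X = conj (kernel F m X)`;
* `nilpotencyClass_grassmannConj`, `grassmannConj_grassmannExp`, `grassmannConj_grassmannLog1p`;
* `grassmannLaplacian_grassmannConj`, `gaussConv_grassmannConj`, `effBoltzmann_grassmannConj`, `effPartitionFn_grassmannConj`,
  **`effAction_grassmannConj`** — `Δ_C ∘ conj = conj ∘ Δ_{C̄}`, …, `effAction C (conj V) = conj (effAction C̄ V)` with
  `C̄ = C.map conj`;
* the ANTILINEAR SYMMETRY form, combined with a relabelling `σ` of the generators (time reversal = frequency reflection ∘ conj):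
  **`map_funLeft_grassmannConj_effAction_of_invariant`** — if `C (σ X) (σ Y) = conj (C X Y)` and `(conj V) ∘ σ⁻¹ = V` then
  `(conj (effAction C V)) ∘ σ⁻¹ = effAction C V`; **`kernel_comp_perm_eq_conj_of_invariant`** — for such an invariant `F`,
  `kernel F m (σ ∘ X) = conj (kernel F m X)`.

Everything is proved; no definitions.  Sources: G. Benfatto, A. Giuliani, V. Mastropietro, Ann. Henri Poincaré 7 (2006) 809,
§2.1 symmetry (5) and §2.3 [`BenfattoGiulianiMastropietro2006`]; I. Montvay, G. Münster, *Quantum Fields on a Lattice* §4.2.3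
(antilinear extension) [`MontvayMunster1994`].
-/

noncomputable section

open scoped ComplexConjugate

namespace Literature.MathematicalPhysics.QuantumLattice

open GrassmannAlgebra Finset Literature.MathematicalPhysics.QuantumFieldTheory

variable {Γ : Type*}

/-! ### Conjugation and the Grassmann calculus -/

/-- Coefficient conjugation is injective (it is an involution). [cite: MontvayMunster1994, §4.2.3 (4.91)] -/
theorem grassmannConj_injective : Function.Injective (grassmannConj (ι := Γ)) :=
  Function.LeftInverse.injective (grassmannConj_grassmannConj (ι := Γ))

/-- Conjugation commutes with rational scalars: `conj (q • a) = q • conj a`. [cite: MontvayMunster1994, §4.2.3 (4.91)] -/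
theorem grassmannConj_rat_smul (q : ℚ) (a : GrassmannAlgebra ℂ Γ) : grassmannConj (q • a) = q • grassmannConj a :=
  map_rat_smul (grassmannConj (ι := Γ)) q a

/-- **Derivatives commute with conjugation**: `∂_X (conj a) = conj (∂_X a)` (the generators have real coefficient vectors).
[cite: BenfattoGiulianiMastropietro2006, §2.1 symmetry (5)] -/
theorem grassmannDeriv_grassmannConj (X : Γ) (a : GrassmannAlgebra ℂ Γ) :
    grassmannDeriv ℂ X (grassmannConj a) = grassmannConj (grassmannDeriv ℂ X a) := by
  induction a using CliffordAlgebra.left_induction with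
  | algebraMap r => rw [grassmannConj_algebraMap, grassmannDeriv_algebraMap, grassmannDeriv_algebraMap, map_zero]
  | add x y hx hy => rw [map_add, map_add, hx, hy, map_add, map_add]
  | ι_mul x v hx =>
    rw [map_mul, grassmannConj_ι, grassmannDeriv_ι_mul, hx, grassmannDeriv_ι_mul, map_sub, grassmannConj_smul, map_mul,
      grassmannConj_ι]
    rfl

/-- Iterated derivatives commute with conjugation. [cite: BenfattoGiulianiMastropietro2006, §2.1 symmetry (5)] -/
theorem iterDeriv_grassmannConj {m : ℕ} (X : Fin m → Γ) (a : GrassmannAlgebra ℂ Γ) :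
    iterDeriv ℂ X (grassmannConj a) = grassmannConj (iterDeriv ℂ X a) := by
  induction m generalizing a with
  | zero => simp [iterDeriv]
  | succ m ih => rw [iterDeriv_succ_apply, iterDeriv_succ_apply ℂ X, grassmannDeriv_grassmannConj, ih]

/-- **The constant part is conjugated**: `(conj a)₀ = conj (a₀)`. [cite: BenfattoGiulianiMastropietro2006, §2.1 symmetry (5)] -/
theorem constPart_grassmannConj (a : GrassmannAlgebra ℂ Γ) : constPart ℂ (grassmannConj a) = conj (constPart ℂ a) := by
  induction a using ExteriorAlgebra.induction with
  | algebraMap c => rw [grassmannConj_algebraMap, constPart_algebraMap, constPart_algebraMap]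
  | ι v => rw [grassmannConj_ι, constPart_ι, constPart_ι, map_zero]
  | mul a b ha hb => rw [map_mul, map_mul, map_mul, ha, hb, map_mul]
  | add a b ha hb => rw [map_add, map_add, map_add, ha, hb, map_add]

/-- **Kernels of a conjugated element are the conjugated kernels**: `kernel (conj F) m X = conj (kernel F m X)`.
[cite: BenfattoGiulianiMastropietro2006, §2.1 symmetry (5)] -/
theorem kernel_grassmannConj (F : GrassmannAlgebra ℂ Γ) (m : ℕ) (X : Fin m → Γ) :
    kernel ℂ (grassmannConj F) m X = conj (kernel ℂ F m X) := by
  rw [kernel, kernel, iterDeriv_grassmannConj, constPart_grassmannConj, map_mul, map_rat_smul, map_one]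

/-- Conjugation preserves the nilpotency class (it is injective and multiplicative).
[cite: BenfattoGiulianiMastropietro2006, §2.1 symmetry (5)] -/
theorem nilpotencyClass_grassmannConj (a : GrassmannAlgebra ℂ Γ) : nilpotencyClass (grassmannConj a) = nilpotencyClass a := by
  unfold nilpotencyClass
  congr 1
  ext k
  simp only [Set.mem_setOf_eq, ← map_pow]
  exact map_eq_zero_iff _ grassmannConj_injective

/-- Conjugation commutes with the exponential. [cite: BenfattoGiulianiMastropietro2006, §2.1 symmetry (5)] -/
theorem grassmannConj_grassmannExp (a : GrassmannAlgebra ℂ Γ) :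
    grassmannConj (grassmannExp a) = grassmannExp (grassmannConj a) := by
  rw [grassmannExp, grassmannExp, IsNilpotent.exp, IsNilpotent.exp, map_sum, nilpotencyClass_grassmannConj]
  simp only [map_rat_smul, map_pow]

/-- Conjugation commutes with the logarithm. [cite: BenfattoGiulianiMastropietro2006, §2.1 symmetry (5)] -/
theorem grassmannConj_grassmannLog1p (x : GrassmannAlgebra ℂ Γ) :
    grassmannConj (grassmannLog1p ℂ x) = grassmannLog1p ℂ (grassmannConj x) := by
  rw [grassmannLog1p, grassmannLog1p, map_sum, nilpotencyClass_grassmannConj]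
  simp only [map_rat_smul, map_pow]

/-! ### Conjugation and the Gaussian integration: `C ↦ C̄` -/

section Gaussian

variable [Fintype Γ]

/-- **The fermionic Laplacian and conjugation**: `Δ_C (conj a) = conj (Δ_{C̄} a)`, `C̄ = C.map conj`.
[cite: BenfattoGiulianiMastropietro2006, §2.1 symmetry (5)] -/
theorem grassmannLaplacian_grassmannConj (C : Matrix Γ Γ ℂ) (a : GrassmannAlgebra ℂ Γ) :
    grassmannLaplacian ℂ C (grassmannConj a) = grassmannConj (grassmannLaplacian ℂ (C.map (starRingEnd ℂ)) a) := by
  rw [grassmannLaplacian_apply, grassmannLaplacian_apply, smul_one_smul, smul_one_smul, grassmannConj_rat_smul, map_sum]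
  congr 1
  refine Finset.sum_congr rfl fun X _ => ?_
  rw [map_sum]
  refine Finset.sum_congr rfl fun Y _ => ?_
  rw [grassmannConj_smul, Matrix.map_apply, starRingEnd_self_apply, grassmannDeriv_grassmannConj,
    grassmannDeriv_grassmannConj]

/-- Powers of the Laplacian and conjugation. [cite: BenfattoGiulianiMastropietro2006, §2.1 symmetry (5)] -/
theorem grassmannLaplacian_pow_grassmannConj (C : Matrix Γ Γ ℂ) (k : ℕ) (a : GrassmannAlgebra ℂ Γ) :
    (grassmannLaplacian ℂ C ^ k) (grassmannConj a) = grassmannConj ((grassmannLaplacian ℂ (C.map (starRingEnd ℂ)) ^ k) a) := by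
  induction k generalizing a with
  | zero => simp
  | succ k ih =>
    rw [pow_succ, pow_succ, Module.End.mul_apply, Module.End.mul_apply, grassmannLaplacian_grassmannConj, ih]

/-- **The Gaussian convolution and conjugation**: `μ_C ⋆ (conj a) = conj (μ_{C̄} ⋆ a)` — the antilinear symmetry (5) of the
Gaussian integration (BGM 2006 §2.1). [cite: BenfattoGiulianiMastropietro2006, §2.1 symmetry (5)] -/
theorem gaussConv_grassmannConj (C : Matrix Γ Γ ℂ) (a : GrassmannAlgebra ℂ Γ) :
    gaussConv ℂ C (grassmannConj a) = grassmannConj (gaussConv ℂ (C.map (starRingEnd ℂ)) a) := by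
  obtain ⟨k₁, hk₁⟩ := isNilpotent_grassmannLaplacian ℂ C
  obtain ⟨k₂, hk₂⟩ := isNilpotent_grassmannLaplacian ℂ (C.map (starRingEnd ℂ))
  have h₁ : grassmannLaplacian ℂ C ^ (k₁ + k₂) = 0 := by rw [pow_add, hk₁, zero_mul]
  have h₂ : grassmannLaplacian ℂ (C.map (starRingEnd ℂ)) ^ (k₁ + k₂) = 0 := by rw [pow_add, hk₂, mul_zero]
  rw [gaussConv, gaussConv, IsNilpotent.exp_eq_sum h₁, IsNilpotent.exp_eq_sum h₂]
  simp only [LinearMap.coe_sum, Finset.sum_apply, LinearMap.smul_apply, map_sum, map_rat_smul,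
    grassmannLaplacian_pow_grassmannConj]

/-- The effective Boltzmann factor and conjugation: `μ_C ⋆ e^{-conj V} = conj (μ_{C̄} ⋆ e^{-V})`.
[cite: BenfattoGiulianiMastropietro2006, §2.1 symmetry (5)] -/
theorem effBoltzmann_grassmannConj (C : Matrix Γ Γ ℂ) (V : GrassmannAlgebra ℂ Γ) :
    effBoltzmann ℂ C (grassmannConj V) = grassmannConj (effBoltzmann ℂ (C.map (starRingEnd ℂ)) V) := by
  rw [effBoltzmann, effBoltzmann, ← map_neg, ← grassmannConj_grassmannExp, gaussConv_grassmannConj]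

/-- The normalised partition function and conjugation: `∫ dμ_C e^{-conj V} = conj (∫ dμ_{C̄} e^{-V})`.
[cite: BenfattoGiulianiMastropietro2006, §2.1 symmetry (5)] -/
theorem effPartitionFn_grassmannConj (C : Matrix Γ Γ ℂ) (V : GrassmannAlgebra ℂ Γ) :
    effPartitionFn ℂ C (grassmannConj V) = conj (effPartitionFn ℂ (C.map (starRingEnd ℂ)) V) := by
  rw [effPartitionFn, effBoltzmann_grassmannConj, constPart_grassmannConj, effPartitionFn]

/-- **The Wilsonian effective action and conjugation**: `effAction C (conj V) = conj (effAction C̄ V)`, `C̄ = C.map conj`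
(BGM 2006 §2.1: the antilinear symmetry (5) passes to the effective potentials). [cite: BenfattoGiulianiMastropietro2006, §2.1 symmetry (5)] -/
theorem effAction_grassmannConj (C : Matrix Γ Γ ℂ) (V : GrassmannAlgebra ℂ Γ) :
    effAction ℂ C (grassmannConj V) = grassmannConj (effAction ℂ (C.map (starRingEnd ℂ)) V) := by
  rw [effAction, effAction, effPartitionFn_grassmannConj, effBoltzmann_grassmannConj, map_neg, grassmannConj_grassmannLog1p,
    map_sub, map_one, grassmannConj_smul, Ring.inverse_eq_inv', map_inv₀]

/-- The same identity read from the other side: `conj (effAction C V) = effAction C̄ (conj V)`.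
[cite: BenfattoGiulianiMastropietro2006, §2.1 symmetry (5)] -/
theorem grassmannConj_effAction (C : Matrix Γ Γ ℂ) (V : GrassmannAlgebra ℂ Γ) :
    grassmannConj (effAction ℂ C V) = effAction ℂ (C.map (starRingEnd ℂ)) (grassmannConj V) := by
  have h := effAction_grassmannConj C (grassmannConj V)
  rw [grassmannConj_grassmannConj] at h
  rw [h, grassmannConj_grassmannConj]

/-! ### The antilinear symmetry: conjugation combined with a relabelling of the generators -/

/-- **An antilinear symmetry of covariance and interaction is a symmetry of the effective action**: for a permutation `σ` of the
labels with `C (σ X) (σ Y) = conj (C X Y)` and `(conj V) ∘ σ⁻¹ = V`, `(conj (effAction C V)) ∘ σ⁻¹ = effAction C V` — BGM 2006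
§2.1, symmetries (5)+(4)-type (time reversal `k₀ ↦ −k₀`, `c ↦ c̄`). [cite: BenfattoGiulianiMastropietro2006, §2.1 symmetry (5)] -/
theorem map_funLeft_grassmannConj_effAction_of_invariant (σ : Equiv.Perm Γ) {C : Matrix Γ Γ ℂ}
    (hC : ∀ X Y, C (σ X) (σ Y) = conj (C X Y)) {V : GrassmannAlgebra ℂ Γ}
    (hV : ExteriorAlgebra.map (LinearMap.funLeft ℂ ℂ σ.symm) (grassmannConj V) = V) :
    ExteriorAlgebra.map (LinearMap.funLeft ℂ ℂ σ.symm) (grassmannConj (effAction ℂ C V)) = effAction ℂ C V := by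
  have hC' : C.submatrix σ σ = C.map (starRingEnd ℂ) := Matrix.ext fun X Y => hC X Y
  rw [grassmannConj_effAction, ← hC', ← effAction_map_funLeft ℂ σ C, hV]

omit [Fintype Γ] in
/-- **The kernels of an element invariant under an antilinear symmetry**: if `(conj F) ∘ σ⁻¹ = F` then
`kernel F m (σ ∘ X) = conj (kernel F m X)` (e.g. `W_m(−k₀, …) = conj W_m(k₀, …)`; BGM 2006 §2.3).
[cite: BenfattoGiulianiMastropietro2006, §2.1 symmetry (5)] -/
theorem kernel_comp_perm_eq_conj_of_invariant (σ : Equiv.Perm Γ) {F : GrassmannAlgebra ℂ Γ}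
    (hF : ExteriorAlgebra.map (LinearMap.funLeft ℂ ℂ σ.symm) (grassmannConj F) = F) (m : ℕ) (X : Fin m → Γ) :
    kernel ℂ F m (σ ∘ X) = conj (kernel ℂ F m X) := by
  conv_lhs => rw [← hF]
  rw [kernel_map_funLeft, kernel_grassmannConj]
  congr 2
  funext i
  simp only [Function.comp_apply, Equiv.symm_apply_apply]

end Gaussian

end Literature.MathematicalPhysics.QuantumLattice
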